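import Literature.AlgebraicGeometry.ShimuraVarieties.UnitaryCurveAuxiliarySymplecticAdelicV
import Literature.AlgebraicGeometry.ShimuraVarieties.UnitaryAuxiliarySymplecticLevel
import HarnessLib

/-!
# Continuity of the `W₀`-free carrier `ũ : U(H)(𝔸_f) × T₀(M)(𝔸_f) → GSp_δ(𝔸_{ℚ,f})` and openness of the levels `K̃_V(m)`, any rank `n`
# (Deligne 1979 Prop. 2.3.10 ∕ 2.1.2, topological clause; Deligne 1971 Prop. 1.15; RSZ 2020 Remark 3.2)

Topic `AlgebraicGeometry/ShimuraVarieties`; namespace `Literature.AlgebraicGeometry.ShimuraVarieties.UnitaryCurve.AuxV`.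
One definition with body (`auxResFinV`) and theorems; no named fact, no instance, nothing asserted (net debt 0).  Cell `hodgecm-mathlib` (D-0151), P6 «MOD
programme», door (E) organ **E1 FILE 3b**: the `V_M`-only twin of ★ `UnitaryCurveAuxiliarySymplecticLevel` (chart shape of the GEN integrator A-p18 (g31),
2026-09-01 21:28:48Z (2)), over ★ FILE 2b `UnitaryCurveAuxiliarySymplecticAdelicV` (`auxToGspFinV`, `auxLevelV`) and the rank-free ★ continuity lemmas of
`UnitaryAuxiliarySymplecticLevel` (`continuous_basis_repr_ratFiniteAdeleTensorEquiv_symm`, `continuous_ratFiniteAdeleTensorEquiv_finAdeleToTensor`, reused by name).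
The one mathematical point is unchanged: `𝔸_{M,f}` and `𝔸_{L,f}` carry the `𝔸_{ℚ,f}`-module topology ([CasselsFrohlichANT1967] II §14 (14.2) «and
topologically»), so the matrix entries of `ũ(a, t)` — `𝔸_{ℚ,f}`-linear coordinate functionals applied to `t · (j-push-forward of an entry of a) · (constant)` —
are continuous.

* §1 the FRAME-FREE carrier `auxResFinV M j H : (a, t) ↦ res(t′·X′) ∈ GL_{n×[M:ℚ]}(𝔸_{ℚ,f})` (★ `resGL` ∘ ★ `blockGLV` ∘ transports), `coe_auxResFinV`,
  **`continuous_coe_auxResFinV`**, **`continuous_auxResFinV`**.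
* §2 `coe_auxToGspFinV_eq_conjRect` (`ũ_β = conjRect(P_β, Q_β) ∘ auxResFinV`), **`continuous_auxToGspFinV F`**.
* §3 **`isOpen_auxLevelV F (hm : m ≠ 0)`**, `isClosed_auxLevelV`, the slices `isOpen_setOf_mk_one_mem_auxLevelV` ∕ `isOpen_setOf_one_mk_mem_auxLevelV`,
  `auxToGspFinV_eq_mul`, `mk_mem_auxLevelV_of_slices`.

`--supports stmt-HodgeConjecture-24832`, count-neutral; HC_CM is proved only modulo the printed citations until rung 0 closes.

## References
* [Deligne1979ShimuraVarieties] P. Deligne, *Variétés de Shimura* (1979), Prop. 2.3.10, 2.1.2 (PDF pp. 32, 24 of Milne's translation).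
* [Deligne1971TravauxShimura] P. Deligne, *Travaux de Shimura* (1971), Prop. 1.15 p. 132, Exemple 4.16 p. 150, 4.9 p. 147.
* [CasselsFrohlichANT1967] Cassels–Fröhlich, *Algebraic Number Theory*, Ch. II §14 Lemma (14.2).
* [RapoportSmithlingZhang2020Diagonal] M. Rapoport, B. Smithling, W. Zhang, Compos. Math. 156 (2020), Remark 3.2 (ii)(iii) pp. 9–10.
-/

set_option autoImplicit false

noncomputable section

open Matrix NumberField IsDedekindDomain
open _root_.Topology
open scoped TensorProduct NumberField.AdeleRing

namespace Literature.AlgebraicGeometry.ShimuraVarieties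

namespace UnitaryCurve

namespace AuxV

open Literature.AlgebraicGeometry.ModuliOfAbelianVarieties
open Literature.AlgebraicGeometry.ShimuraVarieties.UnitaryCanonicalModel.Aux (torusRat torusFinAdelic toTorusFinAdelic coe_toTorusFinAdelic conjAlgHom
  conjAlgHom_apply conjR conjR_tmul ratBasis trace_one_tmul finAdeleToTensor finAdeleToTensor_algebraMap torusToTensorFin basis_repr_map resMatrix_map
  continuous_basis_repr_ratFiniteAdeleTensorEquiv_symm continuous_ratFiniteAdeleTensorEquiv_finAdeleToTensor)
open Literature.AlgebraicGeometry.ShimuraVarieties.UnitaryCurve.Aux (unitaryToTensorFin unitaryToTensorFin_unitary)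
open Literature.NumberTheory.ComplexMultiplication (ratFiniteAdeleTensorEquiv ratFiniteAdeleTensorEquiv_tmul ratFiniteAdeleTensorEquiv_one_tmul
  ratFiniteAdeleTensorEquiv_symm_algebraMap)
open Literature.NumberTheory.Automorphic Literature.NumberTheory.Automorphic.UnitaryGroup

/-! ### §1. The frame-free carrier `(a, t) ↦ res(t′·X′)` and its continuity -/

section ResCarrier

variable {L : Type} [Field L] [NumberField L] [IsCMField L] (M : Type) [Field M] [NumberField M] [IsCMField M]
  (j : L →+* M) {n : ℕ} (H : Matrix (Fin n) (Fin n) L)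

/-- **The frame-free carrier `(a, t) ↦ res(t′·X′) ∈ GL_{n×[M:ℚ]}(𝔸_{ℚ,f})`**: restriction of scalars of `t′·X′` (★ `blockGLV`, fed by the transports
★ `torusToTensorFin`, ★ `unitaryToTensorFin`) along the basis `eᵢ ⊗ (1 ⊗ b_k)` of `(𝔸_{ℚ,f} ⊗_ℚ M)^n` (★ `resGL`), BEFORE reading it in a symplectic frame.
[cite: Deligne1971TravauxShimura, 4.9 p. 147 («restriction des scalaires»)] [cite: RapoportSmithlingZhang2020Diagonal, Remark 3.2 (ii)(iii) pp. 9–10] -/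
def auxResFinV :
    ↥(finAdelic (↥(maximalRealSubfield L)) L (IsCMField.complexConj L) n H) × ↥(torusFinAdelic M) →*
      GL (Fin n × Fin (Module.finrank ℚ M)) finAdeleQ :=
  (resGL (m := Fin n) (Algebra.TensorProduct.basis finAdeleQ (ratBasis M))).comp
    ((blockGLV (finAdeleQ ⊗[ℚ] M)).comp
      (MonoidHom.prod ((torusToTensorFin M).comp (MonoidHom.snd _ _)) ((unitaryToTensorFin M j H).comp (MonoidHom.fst _ _))))

/-- Underlying matrix of `auxResFinV (a, t)`: `resMatrix B (t′·X′)`. [cite: Deligne1971TravauxShimura, 4.9 p. 147] -/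
theorem coe_auxResFinV (p : ↥(finAdelic (↥(maximalRealSubfield L)) L (IsCMField.complexConj L) n H) × ↥(torusFinAdelic M)) :
    ((auxResFinV M j H p : GL (Fin n × Fin (Module.finrank ℚ M)) finAdeleQ) :
        Matrix (Fin n × Fin (Module.finrank ℚ M)) (Fin n × Fin (Module.finrank ℚ M)) finAdeleQ) =
      resMatrix (Algebra.TensorProduct.basis finAdeleQ (ratBasis M))
        ((blockGLV (finAdeleQ ⊗[ℚ] M) (torusToTensorFin M p.2, unitaryToTensorFin M j H p.1) : GL (Fin n) (finAdeleQ ⊗[ℚ] M)) :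
          Matrix (Fin n) (Fin n) (finAdeleQ ⊗[ℚ] M)) :=
  rfl

/-- **The matrix of `auxResFinV (a, t)` depends continuously on `(a, t)`** — entrywise an `𝔸_{ℚ,f}`-linear coordinate functional of `𝔸_{M,f}` applied to
`t · (j-push-forward of an entry of a) · (constant)`. [cite: CasselsFrohlichANT1967, Ch. II §14 Lemma (14.2)] [cite: Deligne1979ShimuraVarieties, Prop. 2.3.10 (PDF p. 32)] -/
theorem continuous_coe_auxResFinV :
    Continuous fun p : ↥(finAdelic (↥(maximalRealSubfield L)) L (IsCMField.complexConj L) n H) × ↥(torusFinAdelic M) =>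
      ((auxResFinV M j H p : GL (Fin n × Fin (Module.finrank ℚ M)) finAdeleQ) :
        Matrix (Fin n × Fin (Module.finrank ℚ M)) (Fin n × Fin (Module.finrank ℚ M)) finAdeleQ) := by
  -- the variable pieces over `𝔸_{M,f}`: the torus coordinate `t` and the push-forward `X` of `a` along `j`
  have hT : Continuous fun p : ↥(finAdelic (↥(maximalRealSubfield L)) L (IsCMField.complexConj L) n H) ×
      ↥(torusFinAdelic M) => (((p.2 : ↥(torusFinAdelic M)) : (FiniteAdeleRing (𝓞 M) M)ˣ) : FiniteAdeleRing (𝓞 M) M) :=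
    Units.continuous_val.comp (continuous_subtype_val.comp continuous_snd)
  have hX : Continuous fun p : ↥(finAdelic (↥(maximalRealSubfield L)) L (IsCMField.complexConj L) n H) ×
      ↥(torusFinAdelic M) =>
      ((((p.1 : ↥(finAdelic (↥(maximalRealSubfield L)) L (IsCMField.complexConj L) n H)) :
          GL (Fin n) (FiniteAdeleRing (𝓞 L) L)) : Matrix (Fin n) (Fin n) (FiniteAdeleRing (𝓞 L) L)).map
        fun y => ratFiniteAdeleTensorEquiv M (finAdeleToTensor M j y)) :=
    (Units.continuous_val.comp (continuous_subtype_val.comp continuous_fst)).matrix_map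
      (continuous_ratFiniteAdeleTensorEquiv_finAdeleToTensor M j)
  have hBlk : Continuous fun p : ↥(finAdelic (↥(maximalRealSubfield L)) L (IsCMField.complexConj L) n H) ×
      ↥(torusFinAdelic M) =>
      (((p.2 : ↥(torusFinAdelic M)) : (FiniteAdeleRing (𝓞 M) M)ˣ) : FiniteAdeleRing (𝓞 M) M) •
        ((((p.1 : ↥(finAdelic (↥(maximalRealSubfield L)) L (IsCMField.complexConj L) n H)) :
            GL (Fin n) (FiniteAdeleRing (𝓞 L) L)) : Matrix (Fin n) (Fin n) (FiniteAdeleRing (𝓞 L) L)).map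
          fun y => ratFiniteAdeleTensorEquiv M (finAdeleToTensor M j y)) :=
    hT.smul hX
  refine continuous_matrix fun ik il => ?_
  obtain ⟨i, k⟩ := ik
  obtain ⟨i', l⟩ := il
  have heq : (fun p : ↥(finAdelic (↥(maximalRealSubfield L)) L (IsCMField.complexConj L) n H) × ↥(torusFinAdelic M) =>
      ((auxResFinV M j H p : GL (Fin n × Fin (Module.finrank ℚ M)) finAdeleQ) :
        Matrix (Fin n × Fin (Module.finrank ℚ M)) (Fin n × Fin (Module.finrank ℚ M)) finAdeleQ) (i, k) (i', l)) =
      fun p => (Algebra.TensorProduct.basis finAdeleQ (ratBasis M)).repr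
        ((ratFiniteAdeleTensorEquiv M).symm
          ((((((p.2 : ↥(torusFinAdelic M)) : (FiniteAdeleRing (𝓞 M) M)ˣ) : FiniteAdeleRing (𝓞 M) M) •
              ((((p.1 : ↥(finAdelic (↥(maximalRealSubfield L)) L (IsCMField.complexConj L) n H)) :
                  GL (Fin n) (FiniteAdeleRing (𝓞 L) L)) : Matrix (Fin n) (Fin n) (FiniteAdeleRing (𝓞 L) L)).map
                fun y => ratFiniteAdeleTensorEquiv M (finAdeleToTensor M j y)))) i i' *
            algebraMap M (FiniteAdeleRing (𝓞 M) M) (ratBasis M l))) k := by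
    funext p
    rw [coe_auxResFinV, resMatrix_apply]
    congr 2
    apply (ratFiniteAdeleTensorEquiv M).injective
    rw [RingEquiv.apply_symm_apply, map_mul, Algebra.TensorProduct.basis_apply, ratFiniteAdeleTensorEquiv_one_tmul]
    congr 1
    have hmap := coe_blockGLV_map ((ratFiniteAdeleTensorEquiv M : finAdeleQ ⊗[ℚ] M ≃+* FiniteAdeleRing (𝓞 M) M) :
        finAdeleQ ⊗[ℚ] M →+* FiniteAdeleRing (𝓞 M) M) (torusToTensorFin M p.2) (unitaryToTensorFin M j H p.1)
    have hentry := congrFun (congrFun hmap i) i'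
    rw [Matrix.map_apply] at hentry
    rw [RingHom.coe_coe] at hentry
    rw [hentry, coe_blockGLV]
    -- the scalar `e(t′) = t` (`e ∘ e⁻¹ = id`); the matrix factor agrees definitionally
    rw [Matrix.smul_apply, Matrix.smul_apply]
    congr 1
    · exact (ratFiniteAdeleTensorEquiv M).apply_symm_apply _
  rw [heq]
  exact (continuous_basis_repr_ratFiniteAdeleTensorEquiv_symm M k).comp ((hBlk.matrix_elem i i').mul continuous_const)

/-- **`auxResFinV M j H : U(H)(𝔸_f) × T₀(M)(𝔸_f) → GL_{n×[M:ℚ]}(𝔸_{ℚ,f})` is continuous** (units topology; the inverse matrix via the homomorphism property).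
[cite: Deligne1979ShimuraVarieties, Prop. 2.3.10 (PDF p. 32)] -/
theorem continuous_auxResFinV : Continuous (auxResFinV M j H) := by
  rw [Units.continuous_iff]
  refine ⟨continuous_coe_auxResFinV M j H, ?_⟩
  exact ((continuous_coe_auxResFinV M j H).comp continuous_inv).congr fun p => by
    simp only [Function.comp_apply, map_inv]

end ResCarrier

/-! ### §2. `ũ_β = conjRect(P_β, Q_β) ∘ auxResFinV` and the continuity of `ũ_β` -/

section Cont

variable {L : Type} [Field L] [NumberField L] [IsCMField L] {M : Type} [Field M] [NumberField M] [IsCMField M]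
  {j : L →+* M} {n : ℕ} {H : Matrix (Fin n) (Fin n) L} {ξ : M} {g : ℕ} {δ : Fin g → ℕ}

/-- **`ũ_β = conjRect(P_β, Q_β) ∘ auxResFinV`**: the framed carrier ★ `auxToGspFinV F` is the frame-free one read in the symplectic frame.
[cite: Deligne1979ShimuraVarieties, Prop. 2.3.10 (PDF p. 32)] -/
theorem coe_auxToGspFinV_eq_conjRect (F : SymplecticFrameV M j H ξ g δ)
    (p : ↥(finAdelic (↥(maximalRealSubfield L)) L (IsCMField.complexConj L) n H) × ↥(torusFinAdelic M)) :
    (auxToGspFinV F p : GL (Fin g ⊕ Fin g) finAdeleQ) =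
      conjRect (framePVR finAdeleQ F) (frameQVR finAdeleQ F) (framePVR_mul_frameQVR finAdeleQ F) (frameQVR_mul_framePVR finAdeleQ F)
        (auxResFinV M j H p) := by
  obtain ⟨a, t⟩ := p
  rfl

/-- The underlying matrix of `ũ_β(a, t)` is `P · res(t′·X′) · Q` (unfolding). [cite: Deligne1979ShimuraVarieties, Prop. 2.3.10 (PDF p. 32)] -/
theorem coe_auxToGspFinV_eq (F : SymplecticFrameV M j H ξ g δ)
    (p : ↥(finAdelic (↥(maximalRealSubfield L)) L (IsCMField.complexConj L) n H) × ↥(torusFinAdelic M)) :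
    ((auxToGspFinV F p : GL (Fin g ⊕ Fin g) finAdeleQ) : Matrix (Fin g ⊕ Fin g) (Fin g ⊕ Fin g) finAdeleQ) =
      framePVR finAdeleQ F *
        ((auxResFinV M j H p : GL (Fin n × Fin (Module.finrank ℚ M)) finAdeleQ) :
          Matrix (Fin n × Fin (Module.finrank ℚ M)) (Fin n × Fin (Module.finrank ℚ M)) finAdeleQ) *
        frameQVR finAdeleQ F := by
  rw [coe_auxToGspFinV_eq_conjRect, coe_conjRect]

/-- **The matrix of `ũ_β(a, t)` depends continuously on `(a, t)`** (`P`, `Q` constant, `res(t′·X′)` continuous).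
[cite: Deligne1979ShimuraVarieties, Prop. 2.3.10 (PDF p. 32)] [cite: CasselsFrohlichANT1967, Ch. II §14 Lemma (14.2)] -/
theorem continuous_coe_auxToGspFinV (F : SymplecticFrameV M j H ξ g δ) :
    Continuous fun p : ↥(finAdelic (↥(maximalRealSubfield L)) L (IsCMField.complexConj L) n H) × ↥(torusFinAdelic M) =>
      ((auxToGspFinV F p : GL (Fin g ⊕ Fin g) finAdeleQ) : Matrix (Fin g ⊕ Fin g) (Fin g ⊕ Fin g) finAdeleQ) := by
  have hfun : (fun p : ↥(finAdelic (↥(maximalRealSubfield L)) L (IsCMField.complexConj L) n H) × ↥(torusFinAdelic M) =>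
      ((auxToGspFinV F p : GL (Fin g ⊕ Fin g) finAdeleQ) : Matrix (Fin g ⊕ Fin g) (Fin g ⊕ Fin g) finAdeleQ)) =
      fun p => framePVR finAdeleQ F *
        ((auxResFinV M j H p : GL (Fin n × Fin (Module.finrank ℚ M)) finAdeleQ) :
          Matrix (Fin n × Fin (Module.finrank ℚ M)) (Fin n × Fin (Module.finrank ℚ M)) finAdeleQ) *
        frameQVR finAdeleQ F := funext fun p => coe_auxToGspFinV_eq F p
  rw [hfun]
  exact (continuous_const.matrix_mul (continuous_coe_auxResFinV M j H)).matrix_mul continuous_const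

/-- **`ũ_β = auxToGspFinV F : U(H)(𝔸_f) × T₀(M)(𝔸_f) → GSp_δ(𝔸_{ℚ,f})` is continuous** (units topology on both sides).
[cite: Deligne1979ShimuraVarieties, Prop. 2.3.10, 2.1.2 (PDF pp. 32, 24)] -/
theorem continuous_auxToGspFinV (F : SymplecticFrameV M j H ξ g δ) : Continuous (auxToGspFinV F) := by
  rw [Topology.IsInducing.subtypeVal.continuous_iff, Units.continuous_iff]
  refine ⟨continuous_coe_auxToGspFinV F, ?_⟩
  exact ((continuous_coe_auxToGspFinV F).comp continuous_inv).congr fun p => by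
    simp only [Function.comp_apply, map_inv, Subgroup.coe_inv]

end Cont

/-! ### §3. The auxiliary levels `K̃_V(m)` are open and closed; their slices are open -/

section Level

variable {L : Type} [Field L] [NumberField L] [IsCMField L] {M : Type} [Field M] [NumberField M] [IsCMField M]
  {j : L →+* M} {n : ℕ} {H : Matrix (Fin n) (Fin n) L} {ξ : M} {g : ℕ} {δ : Fin g → ℕ}

/-- **`K̃_V(m) = ũ_β⁻¹(K_δ(m))` is OPEN in `U(H)(𝔸_f) × T₀(M)(𝔸_f)` for `m ≠ 0`** (preimage of the open `K_δ(m)`, ★ `isOpen_principalLevelSubgroup`, under the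
continuous `ũ_β`). [cite: Deligne1971TravauxShimura, Prop. 1.15 p. 132, Exemple 4.16 p. 150] -/
theorem isOpen_auxLevelV (F : SymplecticFrameV M j H ξ g δ) {m : ℕ} (hm : m ≠ 0) :
    IsOpen (auxLevelV F m : Set (↥(finAdelic (↥(maximalRealSubfield L)) L (IsCMField.complexConj L) n H) × ↥(torusFinAdelic M))) :=
  (isOpen_principalLevelSubgroup δ hm).preimage (continuous_auxToGspFinV F)

/-- `K̃_V(m)` is closed for `m ≠ 0` (an open subgroup is closed). [cite: Deligne1971TravauxShimura, Prop. 1.15 p. 132] -/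
theorem isClosed_auxLevelV (F : SymplecticFrameV M j H ξ g δ) {m : ℕ} (hm : m ≠ 0) :
    IsClosed (auxLevelV F m : Set (↥(finAdelic (↥(maximalRealSubfield L)) L (IsCMField.complexConj L) n H) × ↥(torusFinAdelic M))) :=
  Subgroup.isClosed_of_isOpen _ (isOpen_auxLevelV F hm)

/-- **The unitary slice `{k | (k, 1) ∈ K̃_V(m)}` is open in `U(H)(𝔸_f)`** (`m ≠ 0`). [cite: Deligne1971TravauxShimura, Prop. 1.15 p. 132] -/
theorem isOpen_setOf_mk_one_mem_auxLevelV (F : SymplecticFrameV M j H ξ g δ) {m : ℕ} (hm : m ≠ 0) :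
    IsOpen {k : ↥(finAdelic (↥(maximalRealSubfield L)) L (IsCMField.complexConj L) n H) | (k, 1) ∈ auxLevelV F m} :=
  (isOpen_auxLevelV F hm).preimage (Continuous.prodMk_left 1)

/-- **The torus slice `{t | (1, t) ∈ K̃_V(m)}` is open in `T₀(M)(𝔸_f)`** (`m ≠ 0`). [cite: Deligne1971TravauxShimura, Prop. 1.15 p. 132] -/
theorem isOpen_setOf_one_mk_mem_auxLevelV (F : SymplecticFrameV M j H ξ g δ) {m : ℕ} (hm : m ≠ 0) :
    IsOpen {t : ↥(torusFinAdelic M) | (1, t) ∈ auxLevelV F m} :=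
  (isOpen_auxLevelV F hm).preimage (Continuous.prodMk_right 1)

/-- `(k, t) ∈ K̃_V(m)` splits as `ũ(1, t)·ũ(k, 1) ∈ K_δ(m)` (the group law). [cite: Deligne1979ShimuraVarieties, Prop. 2.3.10 (PDF p. 32)] -/
theorem auxToGspFinV_eq_mul (F : SymplecticFrameV M j H ξ g δ)
    (k : ↥(finAdelic (↥(maximalRealSubfield L)) L (IsCMField.complexConj L) n H)) (t : ↥(torusFinAdelic M)) :
    auxToGspFinV F (k, t) = auxToGspFinV F (1, t) * auxToGspFinV F (k, 1) := by
  rw [← map_mul, Prod.mk_mul_mk, one_mul, mul_one]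

/-- If the slices lie in `K̃_V(m)` then so does the pair. [cite: Deligne1971TravauxShimura, Prop. 1.15 p. 132] -/
theorem mk_mem_auxLevelV_of_slices (F : SymplecticFrameV M j H ξ g δ) {m : ℕ}
    {k : ↥(finAdelic (↥(maximalRealSubfield L)) L (IsCMField.complexConj L) n H)} {t : ↥(torusFinAdelic M)}
    (hk : (k, 1) ∈ auxLevelV F m) (ht : (1, t) ∈ auxLevelV F m) : (k, t) ∈ auxLevelV F m := by
  have h := Subgroup.mul_mem _ ht hk
  rwa [Prod.mk_mul_mk, one_mul, mul_one] at h

end Level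

end AuxV

end UnitaryCurve

end Literature.AlgebraicGeometry.ShimuraVarieties

end
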